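import Mathlib
import HarnessLib
import Summits.HubbardSuperconductivity.HubbardSuperconductivity.Theorems.KLProgrammeKLRegimeEngineScaleZeroKernelNormsWt4Q7
import Summits.HubbardSuperconductivity.HubbardSuperconductivity.Theorems.KLProgrammeKLRegimeEngineV8DefsU10
import Summits.HubbardSuperconductivity.HubbardSuperconductivity.Theorems.KLProgrammeKLRegimeEngineV8DefsL4
import Summits.HubbardSuperconductivity.HubbardSuperconductivity.Theorems.KLProgrammeKLRegimeEngineV8RaiseDoors
import Summits.HubbardSuperconductivity.HubbardSuperconductivity.Theorems.KLProgrammeKLRegimeKernelNormsLevelsScaleZero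

/-!
# Route `KLProgramme` — ENGINE child `KLRegimeEngineV17F2` (stmt-HubbardSuperconductivity-20437): the LEVEL-ZERO kernel-norm package at ANY admissible
# frame, raise-generic — the `j = 0` summand of stub (b) `stub_engine_step_norms`' middle conjunct, supplied by the scale-0 rung once and for all
# (cell gate-hubbard-kl, seat hubbard-kl-k3c2-p1 g7, row «scale-0 Gram step `stub_engine_scale0`, κ² ≍ (1/π) log M»)

Stub (b) concludes, at every scale `n ≥ 1` and AT THE FLOW FRAME `K_n = klFlowFrameU L M β U μ n`,
`… ∧ (∀ j ≤ n, KernelNormsLevels L M P Q β U μ K_n j ∧ KernelNormsWt4 L M (klWtBudget P Q U j) β U μ K_n j) ∧ …`;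
its `j = 0` summand is a SCALE-0 statement read at a scale-`n` frame.  This lineage's scale-0 theorems are frame-generic
(`kernelNormsV4_zero_klEngQ5 … K hK`, `kernelNormsWt4_zero_klWtBudget_klEngQ7U9 … K hK`: only `FrameOK R U (nScales β) μ K` is read — the
infrared-cut scale-0 covariance has the `M`-free Gram majorant `κ₀² = 2(7+6047)` at every admissible frame; the bare slice alone would give
`κ² ≍ (1/π) log M`), so the summand is available at `K_n` for every `n`, and along any raise `Q` of `klEngQ7 P R` (v2 tokens #13
`klEngQ8/klEngQ9 = raises of klEngQ7`) by the `CE`-monotone doors of …EngineV8RaiseDoors.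

* §1 `kernelNormsV4_zero_klEngQ7_frame` — (E1-v4)₀ at `(klEngQ7 P R)`, any admissible `K`, binders of stub (a) (`c ≤ klEngC₃6`, `U ≤ klEngU₀9`);
* §2 `levelZero_norms_klEngQ7_frame` — `KernelNormsV4 … K 0 ∧ KernelNormsLevels … K 0 ∧ KernelNormsWt4 (klWtBudget P (klEngQ7 P R) U 0) … K 0`;
  `levelZero_norms_frame_of_isRaiseOf` — the same at any `Q` with `(klEngQ7 P R).IsRaiseOf Q`;
  `levelZero_norms_frame_of_isRaiseOf_U10L4` — under the v2 binders (`U ≤ klEngU₀10 P R c`, `klEngL₄ P R β U ≤ L`);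
* §3 `stub_engine_step_norms_levelZero` — LITERALLY the `j = 0` summand of the registered stub (b) (v1 tokens `klEngQ7`, `klEngU₀9`) at `K_n`, every `n`,
  from the stub's own binders (history / regime / engine hypotheses not needed); `…_of_isRaiseOf` — the v2 shape at `(Q, klEngU₀10, klEngL₄)`.

Pure composition of landed theorems (DefsQ5/DefsG6Q6/DefsQ7 lifts, …KernelNormsLevelsScaleZero, …ScaleZeroKernelNormsWt4Q7, …RaiseDoors);
no definition; nothing about the model is asserted beyond them; nothing asserts superconductivity.
References: BGM 2006 §2–§3 [cite: BenfattoGiulianiMastropietro2006].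
-/

noncomputable section

namespace Summit.HubbardSuperconductivity.HubbardSuperconductivity.Theorems.EngineV8

set_option linter.dupNamespace false -- summit = problem name (single-conjunct summit), D-0017

open Real Finset Literature.MathematicalPhysics.QuantumLattice Literature.Probability.LatticeModels
open Summit.HubbardSuperconductivity.HubbardSuperconductivity.Theorems.KLRegimeSplit
open Summit.HubbardSuperconductivity.HubbardSuperconductivity.Theorems.KLProgrammeLegKernels

/-! ## §1 (E1-v4)₀ at `klEngQ7`, any admissible frame -/

/-- **(E1-v4)₀ at `(klEngQ7 P R)`, ANY admissible frame `K`** under the binders of stub (a): `kernelNormsV4_zero_klEngQ5` (frame-generic) lifted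
along `klEngQ5 → klEngQ6 → klEngQ7` (`CE`-monotone raises). -/
theorem kernelNormsV4_zero_klEngQ7_frame (P : SplitConsts) (R : RenConsts) (c : ℝ) (hP : P.WF) (hR : R.WF2) (hc : 0 < c)
    (hc₆ : c ≤ klEngC₃6 P R) (μ : ℝ) (hμ : μ ∈ klWindowC) (U : ℝ) (hU : 0 < U) (hU₉ : U ≤ klEngU₀9 P R c) (β : ℝ)
    (hβ : klBetaMin ≤ β) (hβc : β ≤ Real.exp (c / U ^ 2)) (K : TrigPolyC4v) (hK : FrameOK R U (nScales β) μ K) (L M : ℕ)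
    [NeZero L] [NeZero M] (hL : klEngL₃ β U ≤ L) (hM : klEngM₃ β U L ≤ M) :
    KernelNormsV4 L M P (klEngQ7 P R) β U μ K 0 :=
  kernelNormsV4_klEngQ7_of_klEngQ6 hP (kernelNormsV4_klEngQ6_of_klEngQ5 hP
    (kernelNormsV4_zero_klEngQ5 P R c hP hR hc (hc₆.trans (klEngC₃6_le_klEngC₃3 P R)) μ hμ U hU
      (hU₉.trans (klEngU₀9_le_klEngU₀3 P R c)) β hβ hβc K hK L M hL hM))

/-! ## §2 The level-zero package `V4 ∧ Levels ∧ Wt4` at any frame, and along raises of `klEngQ7` -/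

/-- **LEVEL ZERO AT ANY ADMISSIBLE FRAME, package `klEngQ7 P R`**: `KernelNormsV4 … K 0 ∧ KernelNormsLevels … K 0 ∧
KernelNormsWt4 L M (klWtBudget P (klEngQ7 P R) U 0) β U μ K 0` under the binders of stub (a). -/
theorem levelZero_norms_klEngQ7_frame (P : SplitConsts) (R : RenConsts) (c : ℝ) (hP : P.WF) (hR : R.WF2) (hc : 0 < c)
    (hc₆ : c ≤ klEngC₃6 P R) (μ : ℝ) (hμ : μ ∈ klWindowC) (U : ℝ) (hU : 0 < U) (hU₉ : U ≤ klEngU₀9 P R c) (β : ℝ)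
    (hβ : klBetaMin ≤ β) (hβc : β ≤ Real.exp (c / U ^ 2)) (K : TrigPolyC4v) (hK : FrameOK R U (nScales β) μ K) (L M : ℕ)
    [NeZero L] [NeZero M] (hL : klEngL₃ β U ≤ L) (hM : klEngM₃ β U L ≤ M) :
    KernelNormsV4 L M P (klEngQ7 P R) β U μ K 0 ∧ KernelNormsLevels L M P (klEngQ7 P R) β U μ K 0 ∧
      KernelNormsWt4 L M (klWtBudget P (klEngQ7 P R) U 0) β U μ K 0 := by
  have hβ0 : 0 ≤ β := le_trans (by norm_num [klBetaMin]) hβ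
  have h1 := kernelNormsV4_zero_klEngQ7_frame P R c hP hR hc hc₆ μ hμ U hU hU₉ β hβ hβc K hK L M hL hM
  exact ⟨h1, kernelNormsLevels_zero_of_kernelNormsV4 hβ0 h1,
    kernelNormsWt4_zero_klWtBudget_klEngQ7U9 P R c hP hR hc hc₆ μ hμ U hU hU₉ β hβ hβc K hK L M hL hM⟩

/-- **LEVEL ZERO AT ANY ADMISSIBLE FRAME, ANY RAISE `Q` OF `klEngQ7 P R`** (v1 binders): the package of `levelZero_norms_klEngQ7_frame` transported
along `(klEngQ7 P R).IsRaiseOf Q` ((E1-v4), (E1-F) and the weighted level are `CE`-monotone: …EngineV8RaiseDoors). -/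
theorem levelZero_norms_frame_of_isRaiseOf (P : SplitConsts) (R : RenConsts) (Q : EngConsts) (hQ : (klEngQ7 P R).IsRaiseOf Q) (c : ℝ)
    (hP : P.WF) (hR : R.WF2) (hc : 0 < c) (hc₆ : c ≤ klEngC₃6 P R) (μ : ℝ) (hμ : μ ∈ klWindowC) (U : ℝ) (hU : 0 < U)
    (hU₉ : U ≤ klEngU₀9 P R c) (β : ℝ) (hβ : klBetaMin ≤ β) (hβc : β ≤ Real.exp (c / U ^ 2)) (K : TrigPolyC4v)
    (hK : FrameOK R U (nScales β) μ K) (L M : ℕ) [NeZero L] [NeZero M] (hL : klEngL₃ β U ≤ L) (hM : klEngM₃ β U L ≤ M) :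
    KernelNormsV4 L M P Q β U μ K 0 ∧ KernelNormsLevels L M P Q β U μ K 0 ∧ KernelNormsWt4 L M (klWtBudget P Q U 0) β U μ K 0 := by
  have hKl : 0 ≤ P.Klam := zero_le_one.trans hP.1
  have hCE0 : 0 ≤ (klEngQ7 P R).CE := (klEngQ7_wf P R).1
  obtain ⟨h1, h2, h3⟩ := levelZero_norms_klEngQ7_frame P R c hP hR hc hc₆ μ hμ U hU hU₉ β hβ hβc K hK L M hL hM
  exact ⟨kernelNormsV4_of_isRaiseOf hQ hCE0 hKl h1, kernelNormsLevels_of_isRaiseOf hQ hCE0 hKl h2,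
    kernelNormsWt4_klWtBudget_of_isRaiseOf hQ hCE0 hKl h3⟩

/-- **The same under the v2 binders** (token #14 successor `U ≤ klEngU₀10 P R c`, token #16 `klEngL₄ P R β U ≤ L`): doors `klEngU₀10 ≤ klEngU₀9`,
`klEngL₃ ≤ klEngL₄`. -/
theorem levelZero_norms_frame_of_isRaiseOf_U10L4 (P : SplitConsts) (R : RenConsts) (Q : EngConsts) (hQ : (klEngQ7 P R).IsRaiseOf Q)
    (c : ℝ) (hP : P.WF) (hR : R.WF2) (hc : 0 < c) (hc₆ : c ≤ klEngC₃6 P R) (μ : ℝ) (hμ : μ ∈ klWindowC) (U : ℝ) (hU : 0 < U)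
    (hU₁₀ : U ≤ klEngU₀10 P R c) (β : ℝ) (hβ : klBetaMin ≤ β) (hβc : β ≤ Real.exp (c / U ^ 2)) (K : TrigPolyC4v)
    (hK : FrameOK R U (nScales β) μ K) (L M : ℕ) [NeZero L] [NeZero M] (hL : klEngL₄ P R β U ≤ L) (hM : klEngM₃ β U L ≤ M) :
    KernelNormsV4 L M P Q β U μ K 0 ∧ KernelNormsLevels L M P Q β U μ K 0 ∧ KernelNormsWt4 L M (klWtBudget P Q U 0) β U μ K 0 :=
  levelZero_norms_frame_of_isRaiseOf P R Q hQ c hP hR hc hc₆ μ hμ U hU (hU₁₀.trans (klEngU₀10_le_klEngU₀9 P R c)) β hβ hβc K hK L M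
    (klEngL₃_le_of_klEngL₄_le hL) hM

/-! ## §3 The `j = 0` summand of stub (b), literally, at every flow frame `K_n` -/

/-- **THE `j = 0` SUMMAND OF STUB (b) `stub_engine_step_norms` (registered v1 text, tokens `klEngQ7` / `klEngU₀9`) AT `K_n`, EVERY `n`**, from the
stub's own binders — the history, the regime and `1 ≤ n` are not needed at level zero:
`KernelNormsLevels L M P (klEngQ7 P R) β U μ K_n 0 ∧ KernelNormsWt4 L M (klWtBudget P (klEngQ7 P R) U 0) β U μ K_n 0`. -/
theorem stub_engine_step_norms_levelZero :
    ∀ (P : SplitConsts) (R : RenConsts) (c : ℝ), P.WF → R.WF2 → 0 < c → c ≤ klEngC₃6 P R →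
      ∀ μ ∈ klWindowC, ∀ U : ℝ, 0 < U → U ≤ klEngU₀9 P R c → ∀ β : ℝ, klBetaMin ≤ β → β ≤ Real.exp (c / U ^ 2) →
        ∀ (L M : ℕ) [NeZero L] [NeZero M], klEngL₃ β U ≤ L → klEngM₃ β U L ≤ M → ∀ n : ℕ,
          FrameOK R U (nScales β) μ (klFlowFrameU L M β U μ n) →
            KernelNormsLevels L M P (klEngQ7 P R) β U μ (klFlowFrameU L M β U μ n) 0 ∧
              KernelNormsWt4 L M (klWtBudget P (klEngQ7 P R) U 0) β U μ (klFlowFrameU L M β U μ n) 0 :=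
  fun P R c hP hR hc hc₆ μ hμ U hU hU₉ β hβ hβc L M _ _ hL hM _ hK =>
    (levelZero_norms_klEngQ7_frame P R c hP hR hc hc₆ μ hμ U hU hU₉ β hβ hβc _ hK L M hL hM).2

/-- **The v2 shape**: the `j = 0` summand at `(Q, klEngU₀10, klEngL₄)` for any raise `Q` of `klEngQ7 P R`, at `K_n`, every `n`. -/
theorem stub_engine_step_norms_levelZero_of_isRaiseOf (QT : SplitConsts → RenConsts → EngConsts)
    (hQT : ∀ P R, (klEngQ7 P R).IsRaiseOf (QT P R)) :
    ∀ (P : SplitConsts) (R : RenConsts) (c : ℝ), P.WF → R.WF2 → 0 < c → c ≤ klEngC₃6 P R →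
      ∀ μ ∈ klWindowC, ∀ U : ℝ, 0 < U → U ≤ klEngU₀10 P R c → ∀ β : ℝ, klBetaMin ≤ β → β ≤ Real.exp (c / U ^ 2) →
        ∀ (L M : ℕ) [NeZero L] [NeZero M], klEngL₄ P R β U ≤ L → klEngM₃ β U L ≤ M → ∀ n : ℕ,
          FrameOK R U (nScales β) μ (klFlowFrameU L M β U μ n) →
            KernelNormsLevels L M P (QT P R) β U μ (klFlowFrameU L M β U μ n) 0 ∧
              KernelNormsWt4 L M (klWtBudget P (QT P R) U 0) β U μ (klFlowFrameU L M β U μ n) 0 :=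
  fun P R c hP hR hc hc₆ μ hμ U hU hU₁₀ β hβ hβc L M _ _ hL hM _ hK =>
    (levelZero_norms_frame_of_isRaiseOf_U10L4 P R (QT P R) (hQT P R) c hP hR hc hc₆ μ hμ U hU hU₁₀ β hβ hβc _ hK L M hL hM).2

end Summit.HubbardSuperconductivity.HubbardSuperconductivity.Theorems.EngineV8

end
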